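import Summits.Ventures.CertifiedManyBodySolver.Downfold.TPrimePinnedPairRowKernelPoly
import Summits.Ventures.CertifiedManyBodySolver.Rows.CorrWindowCertKernelChainQuotCloser
import HarnessLib

/-!
# The PINNED t′-PAIR shape from TWO HINTED-QUOTIENT CHAIN kernel certificates (symmetry as hints, tables for geometry) sharing ONE
# equation-of-motion word list: `SquareTTPrimePinnedPairRowT.of_quotChainKernelCerts_tb` (cell `pub/hubbard-obs` × `pub/hubbard-downfold`,
# D-0154 (1)(C) COVERAGE La214; seat `hubbard-cov-la214-unc-2`, lineage desk; zero compute)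

HONEST FRAMING: Lean plumbing towards «tier P» for PAIR claim nodes‴ — the T-shape twin of hubbard-obs-p2's single-vertex closer
`CARPolyWindow.affineOrbitLowerRowN_of_quotChainKernelCertTB` (`Rows/CorrWindowCertKernelChainQuotCloser.lean`, p675452; the exporter-facing form of record
for symmetry: NO symmetry family in the instance — the kernel accepts per-slice HINTS, the ACCEPTED moves are the Literature theorem's licensed family,
licensed by the table facts `hokV`): per vertex the hinted chain `ChainQOK D Bkey M Cs (groupSlices (residTGslices … (gramTBslices K blocks) … D.f EB ∅ ∅ CW AV) ns) Hs`
started from the empty accumulator and ONE decidable price `β ≤ lowerConst (decPoly N C_M) + (μ 0 + μ 1)(n₀/2 − ν)`; BOTH vertices over the same tables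
`D : QuotData N Nβ` and ONE shared eom word list `EB` ⟹ `SquareTTPrimePinnedPairRowT U n₀ sA sB capA capB flA flB βA κA κA' βB κB κB' X` via this base's
`SquareTTPrimePinnedPairRowT.of_residPolys` (p673208). Proof per vertex = hubbard-obs-p2's (accepted family `allMoves`, `annotate_ok`,
`shiftSet_subset_of_table`, `d_gq`, `termOp_residTG_moves`, `termOp_symTL_eq`, `evalPoly_chainQ_nil`); `S = D₄` for the pair shape, so no `hokS`.
Nothing is asserted: no `def`, no named fact, no `sorry`, no number; no chain of record exists (nothing evaluated); CONTROL / CALIBRATION wording class (xx1);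
no summit statement is proved by this file.

References: X. Han, arXiv:2006.06002 §3 [Han2020Bootstrap]; J. Wang et al., PRX 14 (2024) 031006 §III [WangEtAl2024]; C. Jansson, D. Chaykin,
C. Keil, SIAM J. Numer. Anal. 46 (2008) 180 [JanssonChaykinKeil2008]; D. P. Bertsekas, *Nonlinear Programming* (1999) Prop. 5.1.3
[Bertsekas1999NonlinearProgramming].
-/

noncomputable section

namespace Summit.Ventures.CertifiedManyBodySolver.Downfold

open Literature.MathematicalPhysics.QuantumLattice
open Matrix HubbardWave0 Literature.Probability.LatticeModels ThermodynamicLimit Filter Topology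
open Literature.MathematicalPhysics.QuantumManyBody.StateRelaxation
open Summit.Ventures.CertifiedQuantumChemistry Summit.Ventures.CertifiedQuantumChemistry.CARPoly
open Summit.Ventures.CertifiedManyBodySolver.CARPolyWindow
open scoped BigOperators ComplexOrder

/-! ## TWO hinted-quotient chains over shared tables with ONE shared eom word list ⇒ the pinned t′-pair shape -/

section KernelPairChainQuot

variable {N Nβ : ℕ} [NeZero N]

/-- **KERNEL FORM OF THE PAIR NODE‴, HINTED-QUOTIENT CHAINS (symmetry as hints), TWO-LEVEL GRAM.** Shared: station `(U, n₀)` rational, hoppings `sA, sB`,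
inner window `Λ ⊆ Λ₇ = box 2 7`, tables `D : QuotData N Nβ` with their specifications (`hxs hix hxsβ hcovβ`), letters `d`/`dΛ` in table form, the table
licence fact `hokV` (decidable), origin letters, the objective family `X`, ONE eom word list `EB`; per vertex: dictionaries at `(1, s_v, U)`, objective
`termOp d TX_v = X s_v`, density rows, cap/cut rows, two-level Gram blocks, charged words, anti-Hermitian parts, the hinted chain `(ns, M, Cs, hC0, Hs, hchain)`
and the price `hβ_v` ⟹ `SquareTTPrimePinnedPairRowT U n₀ sA sB capA capB flA flB βA κA κA' βB κB κB' X`.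
[cite: WangEtAl2024, §III] [cite: Han2020Bootstrap, §3] [cite: JanssonChaykinKeil2008, §3] [cite: Bertsekas1999NonlinearProgramming, Prop. 5.1.3] -/
theorem SquareTTPrimePinnedPairRowT.of_quotChainKernelCerts_tb
    (U : ℚ) (hU : 0 ≤ U) (n₀ : ℚ) (hn0 : 0 ≤ n₀) (hn2 : n₀ < 2) (sA sB : ℚ)
    {Λ : Finset (Site 2)} (hΛ : Λ ⊆ box 2 7) (h8 : thicken Λ 1 ⊆ box 2 7)
    (h0 : thicken ({0} : Finset (Site 2)) 1 ⊆ box 2 7) (hz : (0 : Site 2) ∈ box 2 7)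
    -- tables and letters (shared)
    (D : QuotData N Nβ) (hxs : ∀ i, D.xs i ∈ box 2 7) (hix : ∀ y ∈ box 2 7, D.xs (D.ix y) = y)
    (hxsβ : ∀ j, D.xsβ j ∈ Λ) (hcovβ : ∀ x ∈ Λ, ∃ j, D.xsβ j = x)
    (d : Orb (Fin N) → Orb (PolySite (box 2 7))) (hd : Function.Injective d)
    (hdx : ∀ i σ, d (orb i σ) = orb (PolySite.pt (D.xs i) (hxs i)) σ) (Bkey : ℕ)
    (dΛ : Orb (Fin Nβ) → Orb (PolySite Λ)) (hdΛ : ∀ j σ, dΛ (orb j σ) = orb (PolySite.pt (D.xsβ j) (hxsβ j)) σ)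
    (hf : ∀ b, d (D.f b) = Orb.embMap (PolySite.incl hΛ) (dΛ b))
    (sp : Orb (Fin N) → Fin 2) (hsp : ∀ a, (ofLex (d a)).2 = sp a)
    (hokV : ∀ γc v, D.ok γc v = true →
      ∀ j : Fin Nβ, D.xs (D.ix (d4Vec (d4OfCode γc) (D.xsβ j) + siteOfPair v)) = d4Vec (d4OfCode γc) (D.xsβ j) + siteOfPair v)
    (o : Fin 2 → Orb (Fin N)) (ho : ∀ σ, d (o σ) = orb (PolySite.pt 0 hz) σ)
    -- the objective family and the SHARED eom words
    (X : ℝ → FermionOp (box 2 7)) (EB : List (Terms (Orb (Fin Nβ))))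
    -- vertex A
    (THA : Terms (Orb (Fin N))) (hHA : termOp d THA = (hubbardTTPrimeFermionInteraction 1 (sA : ℝ) (U : ℝ)).localHamiltonian (box 2 7))
    (TEA : Terms (Orb (Fin N)))
    (hEA : termOp d TEA = fermionEmbed (PolySite.incl h0) ((hubbardTTPrimeFermionInteraction 1 (sA : ℝ) (U : ℝ)).meanEnergyObs 1))
    (TXA : Terms (Orb (Fin N))) (hXA : termOp d TXA = X (sA : ℝ)) (μA : Fin 2 → ℚ) (νA κA capA κA' flA : ℚ)
    (KA : ℕ) (blocksA : List (List (List ℤ × Terms (Orb (Fin N)))))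
    (CWA : Terms (Orb (Fin N))) (hcwA : ∀ wc ∈ CWA, chargeW wc.1 ≠ 0 ∨ spinChargeW sp wc.1 ≠ 0)
    (AVA : List (Terms (Orb (Fin N))))
    (nsA : List ℕ) (MA : ℕ) (CsA : List SOSDual.EncPoly) (hC0A : CsA.getD 0 [] = []) (HsA : List (List (QHint Nβ)))
    (hchainA : ChainQOK D Bkey MA CsA
      (groupSlices (residTGslices TXA μA νA o κA capA κA' flA TEA (gramTBslices KA blocksA) THA D.f EB
        (fun l : Fin 0 => l.elim0) (fun l : Fin 0 => l.elim0) CWA AVA) nsA) HsA)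
    {βA : ℚ} (hβA : βA ≤ lowerConst (SOSDual.decPoly N (CsA.getD MA [])) + (μA 0 + μA 1) * (n₀ / 2 - νA))
    -- vertex B
    (THB : Terms (Orb (Fin N))) (hHB : termOp d THB = (hubbardTTPrimeFermionInteraction 1 (sB : ℝ) (U : ℝ)).localHamiltonian (box 2 7))
    (TEB : Terms (Orb (Fin N)))
    (hEB : termOp d TEB = fermionEmbed (PolySite.incl h0) ((hubbardTTPrimeFermionInteraction 1 (sB : ℝ) (U : ℝ)).meanEnergyObs 1))
    (TXB : Terms (Orb (Fin N))) (hXB : termOp d TXB = X (sB : ℝ)) (μB : Fin 2 → ℚ) (νB κB capB κB' flB : ℚ)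
    (KB : ℕ) (blocksB : List (List (List ℤ × Terms (Orb (Fin N)))))
    (CWB : Terms (Orb (Fin N))) (hcwB : ∀ wc ∈ CWB, chargeW wc.1 ≠ 0 ∨ spinChargeW sp wc.1 ≠ 0)
    (AVB : List (Terms (Orb (Fin N))))
    (nsB : List ℕ) (MB : ℕ) (CsB : List SOSDual.EncPoly) (hC0B : CsB.getD 0 [] = []) (HsB : List (List (QHint Nβ)))
    (hchainB : ChainQOK D Bkey MB CsB
      (groupSlices (residTGslices TXB μB νB o κB capB κB' flB TEB (gramTBslices KB blocksB) THB D.f EB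
        (fun l : Fin 0 => l.elim0) (fun l : Fin 0 => l.elim0) CWB AVB) nsB) HsB)
    {βB : ℚ} (hβB : βB ≤ lowerConst (SOSDual.decPoly N (CsB.getD MB [])) + (μB 0 + μB 1) * (n₀ / 2 - νB)) :
    SquareTTPrimePinnedPairRowT (U : ℝ) (n₀ : ℝ) (sA : ℝ) (sB : ℝ) capA capB flA flB βA κA κA' βB κB κB' X := by
  -- vertex A: the accepted move family of its hinted chain, its licences, the semantic residual with that family
  set TsA := groupSlices (residTGslices TXA μA νA o κA capA κA' flA TEA (gramTBslices KA blocksA) THA D.f EB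
    (fun l : Fin 0 => l.elim0) (fun l : Fin 0 => l.elim0) CWA AVA) nsA with hTsA
  set LA := allMoves D Bkey TsA HsA MA with hLA
  have hLokA : ∀ n, ∀ mv ∈ allMoves D Bkey TsA HsA n, D.ok mv.1 mv.2.1 = true := by
    intro n
    induction n with
    | zero => intro mv hmv; rw [allMoves_zero] at hmv; exact absurd hmv List.not_mem_nil
    | succ n ih =>
      intro mv hmv
      rw [allMoves_succ, List.mem_append] at hmv
      rcases hmv with hmv | hmv
      · exact ih mv hmv
      · rw [movesOf, quotMoves, List.mem_filterMap] at hmv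
        obtain ⟨a, ha, hmap⟩ := hmv
        obtain ⟨e, hae, hFe⟩ := Option.map_eq_some_iff.1 hmap
        obtain ⟨hok, -, -⟩ := annotate_ok D Bkey _ _ a ha e hae
        rw [← hFe]
        exact hok
  let γfA : Fin LA.length → DihedralGroup 4 := fun l => d4OfCode (LA.get l).1
  let wvfA : Fin LA.length → Site 2 := fun l => siteOfPair (LA.get l).2.1
  let gfA : Fin LA.length → Orb (Fin Nβ) → Orb (Fin N) := fun l => gq D (γfA l) (wvfA l)
  let SYfA : Fin LA.length → Terms (Orb (Fin Nβ)) := fun l => (LA.get l).2.2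
  have hshA : ∀ l, d4ShiftSet (γfA l) (wvfA l) Λ ⊆ box 2 7 := fun l =>
    shiftSet_subset_of_table D hxs hcovβ (γfA l) (wvfA l) (hokV _ _ (hLokA MA _ (List.get_mem LA l)))
  have hgA : ∀ l b, d (gfA l b) = Orb.embMap (PolySite.incl (hshA l)) (Orb.embMap (PolySite.d4Emb (γfA l) (wvfA l) Λ) (dΛ b)) :=
    fun l b => by rw [← orb_ofLex_eq b]; exact d_gq D hxs d hdx hix hxsβ dΛ hdΛ (γfA l) (wvfA l) (hshA l) _ _
  have hTGA : termOp d (gramTBslices KA blocksA).flatten = gramForm (gramTBCoef KA blocksA) (gramTBOp d blocksA) := by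
    rw [flatten_gramTBslices, termOp_gramTB_eq_gramForm]
  have hRA : evalPoly d (SOSDual.decPoly N (CsA.getD MA [])) =
      termOp d (residTG TXA μA νA o κA capA κA' flA TEA (gramTBslices KA blocksA).flatten THA D.f EB gfA SYfA CWA AVA) := by
    rw [evalPoly_chainQ_nil hd hC0A hchainA, hTsA, flatten_groupSlices, flatten_residTGslices,
      termOp_residTG_moves d TXA μA νA o κA capA κA' flA TEA _ THA D.f EB gfA SYfA CWA AVA, ← hLA, termOp_symTL_eq]
  -- vertex B: the accepted move family of its hinted chain, its licences, the semantic residual with that family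
  set TsB := groupSlices (residTGslices TXB μB νB o κB capB κB' flB TEB (gramTBslices KB blocksB) THB D.f EB
    (fun l : Fin 0 => l.elim0) (fun l : Fin 0 => l.elim0) CWB AVB) nsB with hTsB
  set LB := allMoves D Bkey TsB HsB MB with hLB
  have hLokB : ∀ n, ∀ mv ∈ allMoves D Bkey TsB HsB n, D.ok mv.1 mv.2.1 = true := by
    intro n
    induction n with
    | zero => intro mv hmv; rw [allMoves_zero] at hmv; exact absurd hmv List.not_mem_nil
    | succ n ih =>
      intro mv hmv
      rw [allMoves_succ, List.mem_append] at hmv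
      rcases hmv with hmv | hmv
      · exact ih mv hmv
      · rw [movesOf, quotMoves, List.mem_filterMap] at hmv
        obtain ⟨a, ha, hmap⟩ := hmv
        obtain ⟨e, hae, hFe⟩ := Option.map_eq_some_iff.1 hmap
        obtain ⟨hok, -, -⟩ := annotate_ok D Bkey _ _ a ha e hae
        rw [← hFe]
        exact hok
  let γfB : Fin LB.length → DihedralGroup 4 := fun l => d4OfCode (LB.get l).1
  let wvfB : Fin LB.length → Site 2 := fun l => siteOfPair (LB.get l).2.1
  let gfB : Fin LB.length → Orb (Fin Nβ) → Orb (Fin N) := fun l => gq D (γfB l) (wvfB l)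
  let SYfB : Fin LB.length → Terms (Orb (Fin Nβ)) := fun l => (LB.get l).2.2
  have hshB : ∀ l, d4ShiftSet (γfB l) (wvfB l) Λ ⊆ box 2 7 := fun l =>
    shiftSet_subset_of_table D hxs hcovβ (γfB l) (wvfB l) (hokV _ _ (hLokB MB _ (List.get_mem LB l)))
  have hgB : ∀ l b, d (gfB l b) = Orb.embMap (PolySite.incl (hshB l)) (Orb.embMap (PolySite.d4Emb (γfB l) (wvfB l) Λ) (dΛ b)) :=
    fun l b => by rw [← orb_ofLex_eq b]; exact d_gq D hxs d hdx hix hxsβ dΛ hdΛ (γfB l) (wvfB l) (hshB l) _ _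
  have hTGB : termOp d (gramTBslices KB blocksB).flatten = gramForm (gramTBCoef KB blocksB) (gramTBOp d blocksB) := by
    rw [flatten_gramTBslices, termOp_gramTB_eq_gramForm]
  have hRB : evalPoly d (SOSDual.decPoly N (CsB.getD MB [])) =
      termOp d (residTG TXB μB νB o κB capB κB' flB TEB (gramTBslices KB blocksB).flatten THB D.f EB gfB SYfB CWB AVB) := by
    rw [evalPoly_chainQ_nil hd hC0B hchainB, hTsB, flatten_groupSlices, flatten_residTGslices,
      termOp_residTG_moves d TXB μB νB o κB capB κB' flB TEB _ THB D.f EB gfB SYfB CWB AVB, ← hLB, termOp_symTL_eq]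
  exact SquareTTPrimePinnedPairRowT.of_residPolys U hU n₀ hn0 hn2 sA sB hΛ h8 h0 hz d dΛ D.f hf sp hsp o ho X EB
    THA hHA TEA hEA TXA hXA μA νA κA capA κA' flA (gramTBslices KA blocksA).flatten (gramTBCoef_posSemidef KA blocksA)
    (gramTBOp d blocksA) hTGA γfA wvfA hshA gfA hgA SYfA CWA hcwA AVA hRA hβA
    THB hHB TEB hEB TXB hXB μB νB κB capB κB' flB (gramTBslices KB blocksB).flatten (gramTBCoef_posSemidef KB blocksB)
    (gramTBOp d blocksB) hTGB γfB wvfB hshB gfB hgB SYfB CWB hcwB AVB hRB hβB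

end KernelPairChainQuot

end Summit.Ventures.CertifiedManyBodySolver.Downfold

end
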